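import Summits.HodgeConjecture.HodgeConjecture.Theorems.WeilTypeLadderOnPath
import Literature.AlgebraicGeometry.HodgeTheory.WeilClassesProductsOfFactorsFacts
import HarnessLib

/-!
# WeilTypeLadder · the rungs R1/R1′ (sixfolds) and R2₈ (eightfolds) on PRODUCT LOCI

b2b cell `hweil` (packet `run/shared/lean/b2b/hodge-weil/`, CENSUS.md ## P3-g3), prover 3 gen 3
(strategy: special cases with classical tools). The Literature theorem
`weilClassesOf_prod_le_algebraicClasses` (`HodgeTheory/WeilClassesProductsOfFactors`, PROVED on the
tree's real carriers: Schoen 1998 §10 read downward, `W_K(A₁ × A₂) = W_K(A₁)·W_K(A₂)`) makes every rung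
of the ladder that concerns Weil classes for an imaginary quadratic `K` CLOSED UNDER `K`-EQUIVARIANT
PRODUCTS OF BALANCED FACTORS. This file records the resulting rung instances:

* SIXFOLDS `X⁴ × S²` (item `WeilSixfolds` = R1, stmt-HodgeConjecture-2524, and R1′ `NonsplitSixfolds`):
  `weilSixfolds_fourfoldProdSurface_of_markman2025Fourfold` (mod F1 = Weil classes on all fourfolds,
  arXiv:2502.03415, UNREFEREED), `weilSixfolds_fourfoldProdSurface_of_markman2023` (X hyperbolic; mod
  the REFEREED Markman, JEMS 25 (2023) Thm. 1.3), `weilSixfolds_surfaceProducts` (products of three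
  Weil-type surfaces, UNCONDITIONAL), `weilSixfolds_of_isogeny_fourfoldProdSurface_of_markman2023`
  (isogeny-closed form), the on-path lemma `weilSixfolds_fourfoldProdSurface_of_hodgeConjecture` and
  the arrow from R1 itself;
* EIGHTFOLDS (R2₈ `SplitEightfolds`, and R∞ at `n = 4`): `X⁴ × Y⁴` mod F1 resp. mod Markman 2023
  (both factors hyperbolic), `A⁶ × S²` mod F2 (split sixfolds, arXiv:2502.03415 Thm. 1.5.1), on-path.

WHY THIS BEARS ON R1′ (non-split sixfolds; packet census). The rung's conclusion is proved here for
`(A, φ) = (X × S, φ_X × φ_S)` with NO hypothesis on polarizations. Discriminants of Weil-type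
polarizations multiply under products and every class `δ ∈ ℚ^×/Nm(K^×)` is the discriminant of a
Weil-type SURFACE (Markman, arXiv:2509.23403 §11.5 Step 2, quoting [van-Geemen]); for `δ ≠ -1` these
surfaces are the QM surfaces `S_D`, `D = (-d, -δ)_ℚ ∋ K` a division algebra (anisotropic `K`-Hermitian
plane `H¹(S,ℚ) ≅ D`, `H(v,v) ∝ Nrd v`). Hence for a SPLIT fourfold `X` (refereed input) and such an
`S`, `X × S` lies in the NON-split component `(K, 3, δ)`, and when `X` is simple every `K`-compatible
polarization of `X × S` is non-split (`NS(X × S) = NS(X) ⊕ NS(S)`). So EVERY non-split sixfold component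
contains a `5`-dimensional product locus with algebraic Weil classes and refereed trust base
{Markman 2023 Thm. 1.3, Lefschetz (1,1)} — versus the `0`-dimensional CM anchors recorded so far
(CENSUS §3, `b2b-hweil-pv3-g2/CYCLIC-COVER-BARRIER.md` Finding 3). HONEST LABEL: product members are
NOT general members; R1′ for the general member of any non-split component (`End⁰ = K`, `ρ = 1`) stays
without a known sub-case (Mostaed, arXiv:2603.20268 p. 3). Nothing about discriminants is asserted in
Lean (no Riemann form on the carriers); 0 unconditional rungs above the floor are added; the
unconditional instances (`weilSixfolds_surfaceProducts`) are degenerate (products of surfaces).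
No `sorry`, no new definition, no new fact.
-/

noncomputable section

-- every declaration of this problem lives in `Summit.HodgeConjecture.HodgeConjecture.…` (summit = sub-problem)
set_option linter.dupNamespace false

open CategoryTheory
open Literature.AlgebraicGeometry Literature.AlgebraicGeometry.Motives
open Literature.AlgebraicGeometry.HodgeTheory
open Literature.AlgebraicTopology.SingularHomology

namespace Summit.HodgeConjecture.HodgeConjecture.WeilTypeLadder

/-! ### Sixfolds `X⁴ × S²` (R1 = `WeilSixfolds`, R1′ = `NonsplitSixfolds`) -/

section Sixfolds

variable {X S : AbelianVariety ℂ}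

/-- **R1/R1′ on the product locus `X⁴ × S²`, modulo F1.** Granted
`Markman2025_weilClasses_algebraic_abelianFourfold` (arXiv:2502.03415, unrefereed): for `d ≥ 1`, an
abelian fourfold `(X, φ)`, `φ ≫ φ = -d`, of balanced Weil type `(2,2)` and an abelian surface `(S, ψ)`,
`ψ ≫ ψ = -d`, of type `(1,1)`, the body of `WeilSixfolds` / `NonsplitSixfolds` holds for the sixfold
`(X × S, φ × ψ)`: every rational `(3,3)`-class of `weilClassesOf (X × S) (φ × ψ) 3 d` is algebraic — with
no hypothesis on polarizations (so on the split AND on the non-split product loci; module docstring).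
[cite: Markman2025SurveySecant, Thm. 1.2 and §11.5 Step 2] [cite: Schoen1998HodgeWeilAddendum, §10] -/
theorem weilSixfolds_fourfoldProdSurface_of_markman2025Fourfold
    (hF : Markman2025_weilClasses_algebraic_abelianFourfold) {d : ℕ} (hd : 0 < d)
    (hX : X.dim = 2 * 2) (hS : S.dim = 2 * 1) {φ : X ⟶ X} {ψ : S ⟶ S}
    (hφ : φ ≫ φ = -(d • 𝟙 X)) (hψ : ψ ≫ ψ = -(d • 𝟙 S))
    (hXbal : Module.finrank ℂ ↥(Module.End.eigenspace (complexBetti.map φ.hom.hom.hom 1).hom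
          (Complex.I * (Real.sqrt d : ℂ)) ⊓ hodgeOneZero (Motives.isSmoothProjective_of_dim_eq' hX)) = 2)
    (hSbal : Module.finrank ℂ ↥(Module.End.eigenspace (complexBetti.map ψ.hom.hom.hom 1).hom
          (Complex.I * (Real.sqrt d : ℂ)) ⊓ hodgeOneZero (Motives.isSmoothProjective_of_dim_eq' hS)) = 1) :
    ∀ c : complexBetti (X.prod S).X (2 * 3), IsRationalClass c →
      IsOfHodgeType (2 * 3) (X.prod S).X (2 * 3) 3 3 c →
        c ∈ weilClassesOf (X.prod S)
          (AbelianVariety.prodLift (AbelianVariety.fst X S ≫ φ) (AbelianVariety.snd X S ≫ ψ)) 3 d →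
          c ∈ algebraicClasses (X.prod S).X 3 :=
  fun _ _ _ hcW ↦
    Markman2025_weilClasses_algebraic_abelianFourfold.weilClassesOf_fourfold_prod_surface_le hF hd hX hS
      hφ hψ hXbal hSbal hcW

/-- **R1/R1′ on the product locus `X⁴ × S²` over SPLIT fourfolds — REFEREED trust base.** Granted
`Markman2023_weilClasses_algebraic_discOneWeilFourfold` (Markman, JEMS 25 (2023) Thm. 1.3; = Floccari–Fu,
JMPA 2026, Thm. 1.1): for a hyperbolic (discriminant-`1`) Weil fourfold `(X, φ)` — hyperbolic for the
`K`-symmetrised hyperplane class `d·e^*a + φ^*e^*a` of some projective embedding `e` and rational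
`a ≠ 0` — and an abelian surface `(S, ψ)` of type `(1,1)`, every rational `(3,3)`-class of the Weil plane
of `(X × S, φ × ψ)` is algebraic. With `S` a QM surface for a division algebra `(-d, b)_ℚ ∋ K` the sixfold
`X × S` is of NON-split type, discriminant `-b` (module docstring): every non-split component `(K, 3, δ)`
contains this `5`-dimensional locus. [cite: Markman2023GeneralizedKummers, Theorem 1.3]
[cite: Markman2025SurveySecant, §11.5 Step 2] [cite: Schoen1998HodgeWeilAddendum, §10] -/
theorem weilSixfolds_fourfoldProdSurface_of_markman2023
    (hF : Markman2023_weilClasses_algebraic_discOneWeilFourfold) {d : ℕ} (hd : 0 < d)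
    (hX : X.dim = 2 * 2) (hS : S.dim = 2 * 1) {φ : X ⟶ X} {ψ : S ⟶ S}
    (hφ : φ ≫ φ = -(d • 𝟙 X)) (hψ : ψ ≫ ψ = -(d • 𝟙 S)) (e : ProjectiveEmbedding X.X)
    {a : complexBetti (projectiveSpace e.n ℂ) 2} (ha : IsRationalClass a) (ha0 : a ≠ 0)
    (hhyp : IsHyperbolicWeilType X φ 2
      ((d : ℂ) • complexBetti.map e.ι 2 a + complexBetti.map φ.hom.hom.hom 2 (complexBetti.map e.ι 2 a)))
    (hSbal : Module.finrank ℂ ↥(Module.End.eigenspace (complexBetti.map ψ.hom.hom.hom 1).hom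
          (Complex.I * (Real.sqrt d : ℂ)) ⊓ hodgeOneZero (Motives.isSmoothProjective_of_dim_eq' hS)) = 1) :
    ∀ c : complexBetti (X.prod S).X (2 * 3), IsRationalClass c →
      IsOfHodgeType (2 * 3) (X.prod S).X (2 * 3) 3 3 c →
        c ∈ weilClassesOf (X.prod S)
          (AbelianVariety.prodLift (AbelianVariety.fst X S ≫ φ) (AbelianVariety.snd X S ≫ ψ)) 3 d →
          c ∈ algebraicClasses (X.prod S).X 3 :=
  fun _ _ _ hcW ↦
    Markman2023_weilClasses_algebraic_discOneWeilFourfold.weilClassesOf_fourfold_prod_surface_le hF hd hX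
      hS hφ hψ e ha ha0 hhyp hSbal hcW

/-- **The isogeny-closed product locus, refereed input.** For ANY complex abelian sixfold `(A, Φ)`
admitting an isogeny pair towards `(X × S, φ × ψ)` — `f : A ⟶ X × S` flat, `g : X × S ⟶ A`
`K`-equivariant, `f ≫ g = m • 𝟙 A`, `m ≥ 1` — with `X` a hyperbolic Weil fourfold and `S` a surface of
type `(1,1)` as above, the body of `WeilSixfolds` holds for `(A, Φ)`, granted Markman 2023 Thm. 1.3
(isogeny descent `mem_algebraicClasses_of_isogeny_of_mem_weilClassesOf`).
[cite: Markman2023GeneralizedKummers, Theorem 1.3] [cite: Markman2025SurveySecant, §11.5 Step 1] -/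
theorem weilSixfolds_of_isogeny_fourfoldProdSurface_of_markman2023
    (hF : Markman2023_weilClasses_algebraic_discOneWeilFourfold) {d : ℕ} (hd : 0 < d)
    (hX : X.dim = 2 * 2) (hS : S.dim = 2 * 1) {φ : X ⟶ X} {ψ : S ⟶ S}
    (hφ : φ ≫ φ = -(d • 𝟙 X)) (hψ : ψ ≫ ψ = -(d • 𝟙 S)) (e : ProjectiveEmbedding X.X)
    {a : complexBetti (projectiveSpace e.n ℂ) 2} (ha : IsRationalClass a) (ha0 : a ≠ 0)
    (hhyp : IsHyperbolicWeilType X φ 2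
      ((d : ℂ) • complexBetti.map e.ι 2 a + complexBetti.map φ.hom.hom.hom 2 (complexBetti.map e.ι 2 a)))
    (hSbal : Module.finrank ℂ ↥(Module.End.eigenspace (complexBetti.map ψ.hom.hom.hom 1).hom
          (Complex.I * (Real.sqrt d : ℂ)) ⊓ hodgeOneZero (Motives.isSmoothProjective_of_dim_eq' hS)) = 1)
    {A : AbelianVariety ℂ} {Φ : A ⟶ A} (hA : A.dim = 2 * 3)
    (M : HodgeModel (2 * 3) (X.prod S).X) (f : A ⟶ X.prod S) (g : X.prod S ⟶ A)
    [AlgebraicGeometry.Flat f.hom.hom.hom.left]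
    (hg : g ≫ Φ = AbelianVariety.prodLift (AbelianVariety.fst X S ≫ φ) (AbelianVariety.snd X S ≫ ψ) ≫ g)
    {m : ℕ} (hm : 0 < m) (hfg : f ≫ g = m • 𝟙 A) :
    ∀ c : complexBetti A.X (2 * 3), IsRationalClass c → IsOfHodgeType (2 * 3) A.X (2 * 3) 3 3 c →
      c ∈ weilClassesOf A Φ 3 d → c ∈ algebraicClasses A.X 3 :=
  fun _ hc hcH hcW ↦
    mem_algebraicClasses_of_isogeny_prod (n₁ := 2) (n₂ := 1) two_pos hd hX hS hφ hψ
      (weilClassesOf_le_algebraicClasses_of_isHyperbolicWeilType two_pos hd hX hφ e ha ha0 hhyp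
        (hF d hd X φ hX (Motives.isSmoothProjective_of_dim_eq' hX) hφ e a ha ha0 hhyp))
      (weilClassesOf_le_algebraicClasses_surface hS hd hψ hSbal) hA M f g hg hm hfg hc hcH hcW

variable {S₁ S₂ S₃ : AbelianVariety ℂ}

/-- **R1/R1′ on products of three Weil-type surfaces — UNCONDITIONAL.** For abelian surfaces
`(Sᵢ, ψᵢ)`, `ψᵢ ≫ ψᵢ = -d`, of type `(1,1)` (`i = 1, 2, 3`), every rational `(3,3)`-class of the Weil
plane of the sixfold `((S₁ × S₂) × S₃, (ψ₁ × ψ₂) × ψ₃)` is algebraic (Lefschetz `(1,1)` on the factors,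
DISCHARGED in the tree, and the downward product step twice). A degenerate but unconditional locus in
every sixfold component (discriminant `δ₁δ₂δ₃`). [cite: Schoen1998HodgeWeilAddendum, §10]
[cite: Markman2025SurveySecant, §11.5 Step 2] -/
theorem weilSixfolds_surfaceProducts {d : ℕ} (hd : 0 < d) (hS₁ : S₁.dim = 2 * 1) (hS₂ : S₂.dim = 2 * 1)
    (hS₃ : S₃.dim = 2 * 1) {ψ₁ : S₁ ⟶ S₁} {ψ₂ : S₂ ⟶ S₂} {ψ₃ : S₃ ⟶ S₃}
    (hψ₁ : ψ₁ ≫ ψ₁ = -(d • 𝟙 S₁)) (hψ₂ : ψ₂ ≫ ψ₂ = -(d • 𝟙 S₂)) (hψ₃ : ψ₃ ≫ ψ₃ = -(d • 𝟙 S₃))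
    (hbal₁ : Module.finrank ℂ ↥(Module.End.eigenspace (complexBetti.map ψ₁.hom.hom.hom 1).hom
          (Complex.I * (Real.sqrt d : ℂ)) ⊓ hodgeOneZero (Motives.isSmoothProjective_of_dim_eq' hS₁)) = 1)
    (hbal₂ : Module.finrank ℂ ↥(Module.End.eigenspace (complexBetti.map ψ₂.hom.hom.hom 1).hom
          (Complex.I * (Real.sqrt d : ℂ)) ⊓ hodgeOneZero (Motives.isSmoothProjective_of_dim_eq' hS₂)) = 1)
    (hbal₃ : Module.finrank ℂ ↥(Module.End.eigenspace (complexBetti.map ψ₃.hom.hom.hom 1).hom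
          (Complex.I * (Real.sqrt d : ℂ)) ⊓ hodgeOneZero (Motives.isSmoothProjective_of_dim_eq' hS₃)) = 1) :
    ∀ c : complexBetti ((S₁.prod S₂).prod S₃).X (2 * 3), IsRationalClass c →
      IsOfHodgeType (2 * 3) ((S₁.prod S₂).prod S₃).X (2 * 3) 3 3 c →
        c ∈ weilClassesOf ((S₁.prod S₂).prod S₃)
          (AbelianVariety.prodLift
            (AbelianVariety.fst (S₁.prod S₂) S₃ ≫
              AbelianVariety.prodLift (AbelianVariety.fst S₁ S₂ ≫ ψ₁) (AbelianVariety.snd S₁ S₂ ≫ ψ₂))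
            (AbelianVariety.snd (S₁.prod S₂) S₃ ≫ ψ₃)) 3 d →
          c ∈ algebraicClasses ((S₁.prod S₂).prod S₃).X 3 :=
  fun _ _ _ hcW ↦
    weilClassesOf_surface_prod_surface_prod_surface_le hd hS₁ hS₂ hS₃ hψ₁ hψ₂ hψ₃ hbal₁ hbal₂ hbal₃ hcW

/-- ON-PATH: `HodgeConjecture` ⟹ the product-locus statement for every fourfold `X` and surface `S`
(via R∞ = `WeilClassesImaginaryQuadratic` at `n = 3`, `weilClassesImaginaryQuadratic_of_hodgeConjecture`;
no balancedness needed). A CASE of the summit. -/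
theorem weilSixfolds_fourfoldProdSurface_of_hodgeConjecture (h : _root_.HodgeConjecture) {d : ℕ}
    (hd : 0 < d) (hX : X.dim = 2 * 2) (hS : S.dim = 2 * 1) {φ : X ⟶ X} {ψ : S ⟶ S}
    (hφ : φ ≫ φ = -(d • 𝟙 X)) (hψ : ψ ≫ ψ = -(d • 𝟙 S)) :
    ∀ c : complexBetti (X.prod S).X (2 * 3), IsRationalClass c →
      IsOfHodgeType (2 * 3) (X.prod S).X (2 * 3) 3 3 c →
        c ∈ weilClassesOf (X.prod S)
          (AbelianVariety.prodLift (AbelianVariety.fst X S ≫ φ) (AbelianVariety.snd X S ≫ ψ)) 3 d →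
          c ∈ algebraicClasses (X.prod S).X 3 :=
  have hdim : (X.prod S).dim = 2 * 3 := dim_prod_eq_two_mul hX hS
  weilClassesImaginaryQuadratic_of_hodgeConjecture h 3 (by norm_num) d hd (X.prod S) _ hdim
    (Motives.isSmoothProjective_of_dim_eq' hdim) (prodLift_comp_self_eq_neg_nsmul hφ hψ)

/-- ARROW: the rung R1 (`WeilSixfolds`, stmt-HodgeConjecture-2524) ⟹ its product-locus instance
(trivially: `X × S` is a smooth projective sixfold with `(φ × ψ)² = -d`). -/
theorem weilSixfolds_fourfoldProdSurface_of_weilSixfolds (h : Theses.SevenfoldWeilCensus.WeilSixfolds)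
    {d : ℕ} (hd : 0 < d) (hX : X.dim = 2 * 2) (hS : S.dim = 2 * 1) {φ : X ⟶ X} {ψ : S ⟶ S}
    (hφ : φ ≫ φ = -(d • 𝟙 X)) (hψ : ψ ≫ ψ = -(d • 𝟙 S)) :
    ∀ c : complexBetti (X.prod S).X (2 * 3), IsRationalClass c →
      IsOfHodgeType (2 * 3) (X.prod S).X (2 * 3) 3 3 c →
        c ∈ weilClassesOf (X.prod S)
          (AbelianVariety.prodLift (AbelianVariety.fst X S ≫ φ) (AbelianVariety.snd X S ≫ ψ)) 3 d →
          c ∈ algebraicClasses (X.prod S).X 3 :=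
  have hdim : (X.prod S).dim = 2 * 3 := dim_prod_eq_two_mul hX hS
  weilSixfolds_iff_weilClassesOf.1 h d hd (X.prod S) _ hdim (Motives.isSmoothProjective_of_dim_eq' hdim)
    (prodLift_comp_self_eq_neg_nsmul hφ hψ)

end Sixfolds

/-! ### Eightfolds `X⁴ × Y⁴` and `A⁶ × S²` (R2₈ = `SplitEightfolds`, R∞ at `n = 4`) -/

section Eightfolds

variable {X Y B S : AbelianVariety ℂ}

/-- **R2₈ / R∞(`n = 4`) on the product locus `X⁴ × Y⁴`, modulo F1**: for two abelian fourfolds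
`(X, φ)`, `(Y, χ)` of balanced Weil type `(2,2)` with `φ² = χ² = -d`, every rational `(4,4)`-class of
the Weil plane of the eightfold `(X × Y, φ × χ)` is algebraic (no hypothesis on polarizations: the
`8`-dimensional product loci meet every component, discriminant `δ_X δ_Y`, of the `16`-dimensional
moduli of Weil-type eightfolds). [cite: Markman2025SurveySecant, Thm. 1.2 and §12]
[cite: Schoen1998HodgeWeilAddendum, §10] -/
theorem splitEightfolds_fourfoldProdFourfold_of_markman2025Fourfold
    (hF : Markman2025_weilClasses_algebraic_abelianFourfold) {d : ℕ} (hd : 0 < d)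
    (hX : X.dim = 2 * 2) (hY : Y.dim = 2 * 2) {φ : X ⟶ X} {χ : Y ⟶ Y}
    (hφ : φ ≫ φ = -(d • 𝟙 X)) (hχ : χ ≫ χ = -(d • 𝟙 Y))
    (hXbal : Module.finrank ℂ ↥(Module.End.eigenspace (complexBetti.map φ.hom.hom.hom 1).hom
          (Complex.I * (Real.sqrt d : ℂ)) ⊓ hodgeOneZero (Motives.isSmoothProjective_of_dim_eq' hX)) = 2)
    (hYbal : Module.finrank ℂ ↥(Module.End.eigenspace (complexBetti.map χ.hom.hom.hom 1).hom
          (Complex.I * (Real.sqrt d : ℂ)) ⊓ hodgeOneZero (Motives.isSmoothProjective_of_dim_eq' hY)) = 2) :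
    ∀ c : complexBetti (X.prod Y).X (2 * 4), IsRationalClass c →
      IsOfHodgeType (2 * 4) (X.prod Y).X (2 * 4) 4 4 c →
        c ∈ weilClassesOf (X.prod Y)
          (AbelianVariety.prodLift (AbelianVariety.fst X Y ≫ φ) (AbelianVariety.snd X Y ≫ χ)) 4 d →
          c ∈ algebraicClasses (X.prod Y).X 4 :=
  fun _ _ _ hcW ↦
    Markman2025_weilClasses_algebraic_abelianFourfold.weilClassesOf_fourfold_prod_fourfold_le hF hd hX hY
      hφ hχ hXbal hYbal hcW

/-- **R2₈ on the product locus `X⁴ × Y⁴` over two SPLIT fourfolds — REFEREED trust base** (Markman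
2023 Thm. 1.3 on both factors; the product is a split eightfold, `δ = 1·1`).
[cite: Markman2023GeneralizedKummers, Theorem 1.3] [cite: Schoen1998HodgeWeilAddendum, §10] -/
theorem splitEightfolds_fourfoldProdFourfold_of_markman2023
    (hF : Markman2023_weilClasses_algebraic_discOneWeilFourfold) {d : ℕ} (hd : 0 < d)
    (hX : X.dim = 2 * 2) (hY : Y.dim = 2 * 2) {φ : X ⟶ X} {χ : Y ⟶ Y}
    (hφ : φ ≫ φ = -(d • 𝟙 X)) (hχ : χ ≫ χ = -(d • 𝟙 Y)) (e : ProjectiveEmbedding X.X)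
    {a : complexBetti (projectiveSpace e.n ℂ) 2} (ha : IsRationalClass a) (ha0 : a ≠ 0)
    (hhypX : IsHyperbolicWeilType X φ 2
      ((d : ℂ) • complexBetti.map e.ι 2 a + complexBetti.map φ.hom.hom.hom 2 (complexBetti.map e.ι 2 a)))
    (e' : ProjectiveEmbedding Y.X) {a' : complexBetti (projectiveSpace e'.n ℂ) 2}
    (ha' : IsRationalClass a') (ha0' : a' ≠ 0)
    (hhypY : IsHyperbolicWeilType Y χ 2
      ((d : ℂ) • complexBetti.map e'.ι 2 a' + complexBetti.map χ.hom.hom.hom 2 (complexBetti.map e'.ι 2 a'))) :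
    ∀ c : complexBetti (X.prod Y).X (2 * 4), IsRationalClass c →
      IsOfHodgeType (2 * 4) (X.prod Y).X (2 * 4) 4 4 c →
        c ∈ weilClassesOf (X.prod Y)
          (AbelianVariety.prodLift (AbelianVariety.fst X Y ≫ φ) (AbelianVariety.snd X Y ≫ χ)) 4 d →
          c ∈ algebraicClasses (X.prod Y).X 4 :=
  fun _ _ _ hcW ↦
    Markman2023_weilClasses_algebraic_discOneWeilFourfold.weilClassesOf_fourfold_prod_fourfold_le hF hd
      hX hY hφ hχ e ha ha0 hhypX e' ha' ha0' hhypY hcW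

/-- **R2₈ / R∞(`n = 4`) on the product locus `A⁶ × S²` over SPLIT sixfolds, modulo F2**
(`Markman2025_weilClasses_algebraic_hyperbolicSixfold`, arXiv:2502.03415 Thm. 1.5.1, unrefereed; the
`d = 3` slice is Schoen 1998, refereed): `(A, φ)` a hyperbolic Weil sixfold, `(S, ψ)` a surface of type
`(1,1)`; discriminant of the eightfold `-δ_S` — split for `S ~ E × E`, NON-split for `S` a QM surface by
a division algebra. [cite: Markman2025SecantWeil, Thm. 1.5.1] [cite: Schoen1998HodgeWeilAddendum, §10] -/
theorem splitEightfolds_sixfoldProdSurface_of_markmanSplit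
    (hF : Markman2025_weilClasses_algebraic_hyperbolicSixfold) {d : ℕ} (hd : 0 < d)
    (hB : B.dim = 2 * 3) (hS : S.dim = 2 * 1) {φ : B ⟶ B} {ψ : S ⟶ S}
    (hφ : φ ≫ φ = -(d • 𝟙 B)) (hψ : ψ ≫ ψ = -(d • 𝟙 S)) (e : ProjectiveEmbedding B.X)
    {a : complexBetti (projectiveSpace e.n ℂ) 2} (ha : IsRationalClass a) (ha0 : a ≠ 0)
    (hhyp : IsHyperbolicWeilType B φ 3
      ((d : ℂ) • complexBetti.map e.ι 2 a + complexBetti.map φ.hom.hom.hom 2 (complexBetti.map e.ι 2 a)))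
    (hSbal : Module.finrank ℂ ↥(Module.End.eigenspace (complexBetti.map ψ.hom.hom.hom 1).hom
          (Complex.I * (Real.sqrt d : ℂ)) ⊓ hodgeOneZero (Motives.isSmoothProjective_of_dim_eq' hS)) = 1) :
    ∀ c : complexBetti (B.prod S).X (2 * 4), IsRationalClass c →
      IsOfHodgeType (2 * 4) (B.prod S).X (2 * 4) 4 4 c →
        c ∈ weilClassesOf (B.prod S)
          (AbelianVariety.prodLift (AbelianVariety.fst B S ≫ φ) (AbelianVariety.snd B S ≫ ψ)) 4 d →
          c ∈ algebraicClasses (B.prod S).X 4 :=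
  fun _ _ _ hcW ↦
    Markman2025_weilClasses_algebraic_hyperbolicSixfold.weilClassesOf_sixfold_prod_surface_le hF hd hB hS
      hφ hψ e ha ha0 hhyp hSbal hcW

/-- ON-PATH: `HodgeConjecture` ⟹ the product-locus statement for eightfolds `A₁ × A₂`
(`dim A₁ = 2n₁`, `dim A₂ = 2n₂`, `n₁ + n₂ = 4`), via R∞ at `n = 4`. A CASE of the summit. -/
theorem splitEightfolds_prod_of_hodgeConjecture (h : _root_.HodgeConjecture) {A₁ A₂ : AbelianVariety ℂ}
    {n₁ n₂ d : ℕ} (hn : n₁ + n₂ = 4) (hd : 0 < d) (hA₁ : A₁.dim = 2 * n₁) (hA₂ : A₂.dim = 2 * n₂)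
    {φ₁ : A₁ ⟶ A₁} {φ₂ : A₂ ⟶ A₂} (hφ₁ : φ₁ ≫ φ₁ = -(d • 𝟙 A₁)) (hφ₂ : φ₂ ≫ φ₂ = -(d • 𝟙 A₂)) :
    ∀ c : complexBetti (A₁.prod A₂).X (2 * 4), IsRationalClass c →
      IsOfHodgeType (2 * 4) (A₁.prod A₂).X (2 * 4) 4 4 c →
        c ∈ weilClassesOf (A₁.prod A₂)
          (AbelianVariety.prodLift (AbelianVariety.fst A₁ A₂ ≫ φ₁) (AbelianVariety.snd A₁ A₂ ≫ φ₂)) 4 d →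
          c ∈ algebraicClasses (A₁.prod A₂).X 4 :=
  have hdim : (A₁.prod A₂).dim = 2 * 4 := by rw [dim_prod_eq_two_mul hA₁ hA₂, hn]
  weilClassesImaginaryQuadratic_of_hodgeConjecture h 4 (by norm_num) d hd (A₁.prod A₂) _ hdim
    (Motives.isSmoothProjective_of_dim_eq' hdim) (prodLift_comp_self_eq_neg_nsmul hφ₁ hφ₂)

/-- ARROW: the rung R2₈ (`SplitEightfolds`) — indeed already R∞ at `n = 4` — gives the product-locus
statement WITHOUT any product structure being used; recorded so that the census can cite the exact
implication `R∞(4) ⟹ product instances`. -/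
theorem splitEightfolds_prod_of_weilClassesImaginaryQuadratic (h : WeilClassesImaginaryQuadratic)
    {A₁ A₂ : AbelianVariety ℂ} {n₁ n₂ d : ℕ} (hn : n₁ + n₂ = 4) (hd : 0 < d) (hA₁ : A₁.dim = 2 * n₁)
    (hA₂ : A₂.dim = 2 * n₂) {φ₁ : A₁ ⟶ A₁} {φ₂ : A₂ ⟶ A₂} (hφ₁ : φ₁ ≫ φ₁ = -(d • 𝟙 A₁))
    (hφ₂ : φ₂ ≫ φ₂ = -(d • 𝟙 A₂)) :
    ∀ c : complexBetti (A₁.prod A₂).X (2 * 4), IsRationalClass c →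
      IsOfHodgeType (2 * 4) (A₁.prod A₂).X (2 * 4) 4 4 c →
        c ∈ weilClassesOf (A₁.prod A₂)
          (AbelianVariety.prodLift (AbelianVariety.fst A₁ A₂ ≫ φ₁) (AbelianVariety.snd A₁ A₂ ≫ φ₂)) 4 d →
          c ∈ algebraicClasses (A₁.prod A₂).X 4 :=
  have hdim : (A₁.prod A₂).dim = 2 * 4 := by rw [dim_prod_eq_two_mul hA₁ hA₂, hn]
  h 4 (by norm_num) d hd (A₁.prod A₂) _ hdim (Motives.isSmoothProjective_of_dim_eq' hdim)
    (prodLift_comp_self_eq_neg_nsmul hφ₁ hφ₂)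

end Eightfolds

/-! ### The general closure statement: R∞ is closed under products of balanced factors -/

/-- **Closure of R∞'s conclusion under products (all dimensions).** If the pointwise conclusion of
`WeilClassesImaginaryQuadratic` holds for a balanced `(A₁, φ₁)` of dimension `2n₁` and a balanced
`(A₂, φ₂)` of dimension `2n₂` (same `d`), then it holds for `(A₁ × A₂, φ₁ × φ₂)` in dimension
`2(n₁ + n₂)` — so the open content of every rung R1/R1′/R2₈/R2/R∞ sits with the `K`-ISOTYPIC abelian
varieties of balanced Weil type; unbalanced factor patterns (e.g. `B⁵_{(3,2)} × E_{(0,1)}`) are NOT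
covered by this step (their Weil classes are not products of Hodge classes of the factors).
[cite: Schoen1998HodgeWeilAddendum, §10] [cite: MoonenZarhin1999LowDim, §2 (products)] -/
theorem weilClassesImaginaryQuadratic_prod_of_factors {A₁ A₂ : AbelianVariety ℂ} {n₁ n₂ d : ℕ}
    (hn₁ : 0 < n₁) (hn₂ : 0 < n₂) (hd : 0 < d) (hA₁ : A₁.dim = 2 * n₁) (hA₂ : A₂.dim = 2 * n₂)
    {φ₁ : A₁ ⟶ A₁} {φ₂ : A₂ ⟶ A₂} (hφ₁ : φ₁ ≫ φ₁ = -(d • 𝟙 A₁)) (hφ₂ : φ₂ ≫ φ₂ = -(d • 𝟙 A₂))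
    (hbal₁ : Module.finrank ℂ ↥(Module.End.eigenspace (complexBetti.map φ₁.hom.hom.hom 1).hom
          (Complex.I * (Real.sqrt d : ℂ)) ⊓ hodgeOneZero (Motives.isSmoothProjective_of_dim_eq' hA₁)) = n₁)
    (hbal₂ : Module.finrank ℂ ↥(Module.End.eigenspace (complexBetti.map φ₂.hom.hom.hom 1).hom
          (Complex.I * (Real.sqrt d : ℂ)) ⊓ hodgeOneZero (Motives.isSmoothProjective_of_dim_eq' hA₂)) = n₂)
    (h₁ : ∀ c : complexBetti A₁.X (2 * n₁), IsRationalClass c →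
      IsOfHodgeType (2 * n₁) A₁.X (2 * n₁) n₁ n₁ c → c ∈ weilClassesOf A₁ φ₁ n₁ d →
        c ∈ algebraicClasses A₁.X n₁)
    (h₂ : ∀ c : complexBetti A₂.X (2 * n₂), IsRationalClass c →
      IsOfHodgeType (2 * n₂) A₂.X (2 * n₂) n₂ n₂ c → c ∈ weilClassesOf A₂ φ₂ n₂ d →
        c ∈ algebraicClasses A₂.X n₂) :
    ∀ c : complexBetti (A₁.prod A₂).X (2 * (n₁ + n₂)), IsRationalClass c →
      IsOfHodgeType (2 * (n₁ + n₂)) (A₁.prod A₂).X (2 * (n₁ + n₂)) (n₁ + n₂) (n₁ + n₂) c →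
        c ∈ weilClassesOf (A₁.prod A₂)
          (AbelianVariety.prodLift (AbelianVariety.fst A₁ A₂ ≫ φ₁) (AbelianVariety.snd A₁ A₂ ≫ φ₂))
            (n₁ + n₂) d →
          c ∈ algebraicClasses (A₁.prod A₂).X (n₁ + n₂) :=
  mem_algebraicClasses_prod_of_mem_weilClassesOf hn₁ hd hA₁ hA₂ hφ₁ hφ₂
    (weilClassesOf_le_algebraicClasses_of_forall_isRationalClass hn₁ hA₁ hd hφ₁ hbal₁ h₁)
    (weilClassesOf_le_algebraicClasses_of_forall_isRationalClass hn₂ hA₂ hd hφ₂ hbal₂ h₂)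

end Summit.HodgeConjecture.HodgeConjecture.WeilTypeLadder

end
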